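import Summits.CriticalPhenomena.CardyFormulaZ2.Theorems.CardySusyWardDiscretisationFamilyExistsDefs
import Summits.CriticalPhenomena.CardyFormulaZ2.Theorems.CardySusyWardDiscretisationFamilyExistsLocalSearch
import Summits.CriticalPhenomena.CardyFormulaZ2.Theorems.CardySusyWardDiscretisationFamilyExistsCover
import Summits.CriticalPhenomena.CardyFormulaZ2.Theorems.CardySusyWardDiscretisationFamilyExistsMid
import Mathlib.Analysis.InnerProductSpace.Basic
import HarnessLib

/-!
# The cross-cut through the two legs — helper for `DiscretisationFamilyExists` (stmt-CriticalPhenomena-9644)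

Fixed mesh.  From leg data `La` at the window `ball a η` and `Lb` at `ball b η` (windows
`2η + 12δ` apart) and an open preconnected set `C` of points deeper than `20δ` containing both
deep run ends, `exists_crosscut` builds the cross-cut
`χ = Pₐ ∪ [mₐ, wₐ] ∪ M ∪ [w_b, m_b] ∪ P_b` of the Jordan domain from `La.c` to `Lb.c`
(`M` the middle arc of `…ExistsMid`) and records the finitely many facts about `χ` that the
labelling consumes: boundary-site mesh points are off `χ`; closed `Ω_δ`-edges between boundary
sites meet `χ` only in the two cut midpoints; the sector, access and far-pole box data of both
legs hold for the whole of `χ`; every point of `χ` is in a window or deeper than `20δ`.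
-/

noncomputable section

open Set Metric
open Literature.Probability.LatticeModels Literature.Probability.Percolation
  Literature.Probability.LatticeModels.DiscreteDobrushin Literature.Probability.RandomPlanarGeometry
  Literature.Topology.PlaneTopology

namespace Summit.CriticalPhenomena.CardyFormulaZ2.Theorems.DiscretisationFamilyExists

/-! ### Small metric facts -/

/-- Points of a segment are within the length of the segment of its first end (private copy of
`Literature.Probability.Percolation.dist_left_le_dist_of_mem_segment` of `OrbitLoopDarts.lean`, whose
import cone is not pulled in here). [folklore] -/
private theorem dist_le_dist_of_mem_segment {p q z : ℂ} (hz : z ∈ segment ℝ p q) : dist z p ≤ dist p q := by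
  have : z ∈ closedBall p (dist p q) :=
    (convex_closedBall p (dist p q)).segment_subset (mem_closedBall_self dist_nonneg)
      (mem_closedBall.2 (dist_comm p q ▸ le_rfl)) hz
  exact mem_closedBall.1 this

/-- `infDist` to a set grows at most by the distance moved. [folklore] -/
theorem infDist_le_of_near {F : Set ℂ} {p z : ℂ} {r s : ℝ} (hp : infDist p F ≤ r) (hz : dist z p ≤ s) :
    infDist z F ≤ r + s := by
  have := infDist_le_infDist_add_dist (s := F) (x := z) (y := p)
  linarith

/-- A point within `r` of a frontier point is within `r` of the frontier. [folklore] -/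
theorem infDist_frontier_le_of_dist {Ω : Set ℂ} {c z : ℂ} {r : ℝ} (hc : c ∈ frontier Ω)
    (hz : dist z c ≤ r) : infDist z (frontier Ω) ≤ r :=
  (infDist_le_dist_of_mem hc).trans hz

section Crosscut

variable {J : JordanDomain} {δ η : ℝ} {a b pa pb : ℂ}

/-- Leg data: the plug lies within `5δ` of the frontier. [folklore] -/
theorem LegData.infDist_le_of_mem_P (L : LegData J.carrier δ a η pa) {z : ℂ} (hz : z ∈ L.P) :
    infDist z (frontier J.carrier) ≤ 5 * δ :=
  infDist_frontier_le_of_dist L.c_mem (mem_closedBall.1 (L.subset_closedBall hz))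

/-- Leg data: the sector ball lies within `6δ` of the frontier. [folklore] -/
theorem LegData.infDist_le_of_mem_ball (L : LegData J.carrier δ a η pa) {z : ℂ} (hz : z ∈ ball L.z₀ L.ε) :
    infDist z (frontier J.carrier) ≤ 6 * δ := by
  have h1 := L.infDist_le_of_mem_P L.z₀_mem
  have h2 : dist z L.z₀ ≤ δ := (mem_ball.1 hz).le.trans L.ε_le
  linarith [infDist_le_of_near h1 h2]

/-- Leg data: the window contains the sector ball up to `δ`. [folklore] -/
theorem LegData.ball_z₀_subset (L : LegData J.carrier δ a η pa) : ball L.z₀ L.ε ⊆ ball a (η + δ) := by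
  intro z hz
  have h1 : L.z₀ ∈ ball a η := L.subset_ball (Or.inl L.z₀_mem)
  rw [mem_ball] at hz h1 ⊢
  linarith [dist_triangle z L.z₀ a, L.ε_le]

/-- Leg data: mesh points of the cut ends are in the window up to `5δ`. [folklore] -/
theorem LegData.meshPoint_u_mem (L : LegData J.carrier δ a η pa) : meshPoint δ L.u ∈ ball a (η + 5 * δ) := by
  have h1 : L.c ∈ ball a η := L.subset_ball (Or.inl L.arcP.right_mem)
  rw [mem_ball] at h1 ⊢
  linarith [dist_triangle (meshPoint δ L.u) L.c a, L.dist_u_c]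

/-- Leg data: mesh points of the cut ends are in the window up to `5δ`. [folklore] -/
theorem LegData.meshPoint_v_mem (L : LegData J.carrier δ a η pa) : meshPoint δ L.v ∈ ball a (η + 5 * δ) := by
  have h1 : L.c ∈ ball a η := L.subset_ball (Or.inl L.arcP.right_mem)
  rw [mem_ball] at h1 ⊢
  linarith [dist_triangle (meshPoint δ L.v) L.c a, L.dist_v_c]

end Crosscut

section Main

variable {J : JordanDomain} {δ η : ℝ} {a b pa pb : ℂ}

set_option maxHeartbeats 1600000 in
/-- **The cross-cut through the two legs.** See the module docstring. [folklore] -/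
theorem exists_crosscut (hδ : 0 < δ) (La : LegData J.carrier δ a η pa) (Lb : LegData J.carrier δ b η pb)
    (hsep : 2 * η + 12 * δ ≤ dist a b) {C : Set ℂ} (hC : IsOpen C) (hCc : IsPreconnected C)
    (hCdeep : ∀ z ∈ C, z ∈ J.carrier ∧ 20 * δ < infDist z (frontier J.carrier))
    (hza : La.ztop ∈ C) (hzb : Lb.ztop ∈ C) :
    ∃ χ : Set ℂ, J.IsCrosscut χ La.c Lb.c ∧
      (∀ x ∈ (⟨J.carrier, δ, ∅, ∅⟩ : DiscreteDobrushin).zdBoundary, meshPoint δ x ∉ χ) ∧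
      (∀ x ∈ (⟨J.carrier, δ, ∅, ∅⟩ : DiscreteDobrushin).zdBoundary,
        ∀ y ∈ (⟨J.carrier, δ, ∅, ∅⟩ : DiscreteDobrushin).zdBoundary,
        (discreteDomainGraph J.carrier δ).Adj x y →
        χ ∩ segment ℝ (meshPoint δ x) (meshPoint δ y) ⊆ {La.pstar, Lb.pstar}) ∧
      La.z₀ ∈ χ ∧ Lb.z₀ ∈ χ ∧ La.pstar ∈ χ ∧ Lb.pstar ∈ χ ∧
      χ ∩ ball La.z₀ La.ε ⊆ {z | inner (ℝ) (z - La.z₀) (meshPoint δ La.v - meshPoint δ La.u) = 0} ∧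
      χ ∩ ball Lb.z₀ Lb.ε ⊆ {z | inner (ℝ) (z - Lb.z₀) (meshPoint δ Lb.v - meshPoint δ Lb.u) = 0} ∧
      (∃ q ∈ ball La.z₀ La.ε, 0 < inner (ℝ) (q - La.z₀) (meshPoint δ La.u - meshPoint δ La.v) ∧
        segment ℝ (meshPoint δ La.u) q ⊆ J.carrier \ χ) ∧
      (∃ q ∈ ball La.z₀ La.ε, 0 < inner (ℝ) (q - La.z₀) (meshPoint δ La.v - meshPoint δ La.u) ∧
        segment ℝ (meshPoint δ La.v) q ⊆ J.carrier \ χ) ∧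
      (∃ q ∈ ball Lb.z₀ Lb.ε, 0 < inner (ℝ) (q - Lb.z₀) (meshPoint δ Lb.u - meshPoint δ Lb.v) ∧
        segment ℝ (meshPoint δ Lb.u) q ⊆ J.carrier \ χ) ∧
      (∃ q ∈ ball Lb.z₀ Lb.ε, 0 < inner (ℝ) (q - Lb.z₀) (meshPoint δ Lb.v - meshPoint δ Lb.u) ∧
        segment ℝ (meshPoint δ Lb.v) q ⊆ J.carrier \ χ) ∧
      (∀ p ∈ χ, p ∈ J.carrier → ∀ α β : ℝ, 0 ≤ α → α ≤ 2 → -1 ≤ β → β ≤ 1 →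
        p ≠ meshPoint δ La.v + α • meshPoint δ (cornerUnit La.mv) + β • meshPoint δ (cornerUnit (La.mv + 1))) ∧
      (∀ p ∈ χ, p ∈ J.carrier → ∀ α β : ℝ, 0 ≤ α → α ≤ 2 → -1 ≤ β → β ≤ 1 →
        p ≠ meshPoint δ La.u + α • meshPoint δ (cornerUnit (La.mv + 2)) + β • meshPoint δ (cornerUnit (La.mv + 2 + 1))) ∧
      (∀ p ∈ χ, p ∈ J.carrier → ∀ α β : ℝ, 0 ≤ α → α ≤ 2 → -1 ≤ β → β ≤ 1 →
        p ≠ meshPoint δ Lb.v + α • meshPoint δ (cornerUnit Lb.mv) + β • meshPoint δ (cornerUnit (Lb.mv + 1))) ∧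
      (∀ p ∈ χ, p ∈ J.carrier → ∀ α β : ℝ, 0 ≤ α → α ≤ 2 → -1 ≤ β → β ≤ 1 →
        p ≠ meshPoint δ Lb.u + α • meshPoint δ (cornerUnit (Lb.mv + 2)) + β • meshPoint δ (cornerUnit (Lb.mv + 2 + 1))) ∧
      (∀ z ∈ χ, z ∈ ball a η ∨ z ∈ ball b η ∨ 20 * δ < infDist z (frontier J.carrier)) := by
  obtain ⟨hΩ, hext, hunb, hJE⟩ := regular_of_eq_carrier (D := ⟨J.carrier, δ, ∅, ∅⟩) J rfl
  dsimp only at hΩ hext hunb hJE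
  -- windows are far apart
  have hW : ∀ (z : ℂ) (s t : ℝ), dist z a < s → dist z b < t → s + t ≤ 2 * η + 12 * δ → False := by
    intro z s t h1 h2 h3
    have := dist_triangle_left a b z
    linarith
  have hWa : ∀ z ∈ La.P ∪ segment ℝ La.m La.ztop, dist z a < η := fun z hz => La.subset_ball hz
  have hWb : ∀ z ∈ Lb.P ∪ segment ℝ Lb.m Lb.ztop, dist z b < η := fun z hz => Lb.subset_ball hz
  -- boundary sites are shallow
  have hB : ∀ x ∈ (⟨J.carrier, δ, ∅, ∅⟩ : DiscreteDobrushin).zdBoundary,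
      infDist (meshPoint δ x) (frontier J.carrier) ≤ 2 * δ := fun x hx => by
    have := infDist_frontier_le_sqrt_two (E := ⟨J.carrier, δ, ∅, ∅⟩) hΩ hδ hx
    have hs : Real.sqrt 2 < 2 := by rw [Real.sqrt_lt' (by norm_num)]; norm_num
    exact this.trans (by nlinarith)
  -- the middle arc
  have hma : La.m ∉ C := fun h => by
    have := (hCdeep _ h).2; have := La.infDist_le_of_mem_P La.arcP.left_mem; linarith
  have hmb : Lb.m ∉ C := fun h => by
    have := (hCdeep _ h).2; have := Lb.infDist_le_of_mem_P Lb.arcP.left_mem; linarith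
  have hruns : Disjoint (segment ℝ La.m La.ztop) (segment ℝ Lb.m Lb.ztop) :=
    Set.disjoint_left.2 fun z hz hz' => hW z η η (hWa z (Or.inr hz)) (hWb z (Or.inr hz')) (by linarith)
  obtain ⟨wa, hwa, wb, hwb, M, hM, hMC, hMa, hMb, hwane, hwbne⟩ := exists_mid_arc hC hCc hza hzb hma hmb hruns
  have hMdeep : ∀ z ∈ M, 20 * δ < infDist z (frontier J.carrier) := fun z hz => (hCdeep z (hMC hz)).2
  have hMΩ : M ⊆ J.carrier := fun z hz => (hCdeep z (hMC hz)).1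
  have hSa : segment ℝ La.m wa ⊆ segment ℝ La.m La.ztop := segment_subset_of_mem hwa
  have hSb : segment ℝ wb Lb.m ⊆ segment ℝ Lb.m Lb.ztop := by
    rw [segment_symm]; exact segment_subset_of_mem hwb
  -- pieces versus pieces
  have hPaM : ∀ z ∈ La.P, z ∉ M := fun z hz hzM => by
    have := La.infDist_le_of_mem_P hz; have := hMdeep z hzM; linarith
  have hPbM : ∀ z ∈ Lb.P, z ∉ M := fun z hz hzM => by
    have := Lb.infDist_le_of_mem_P hz; have := hMdeep z hzM; linarith
  have hab : ∀ z ∈ La.P ∪ segment ℝ La.m La.ztop, z ∉ Lb.P ∪ segment ℝ Lb.m Lb.ztop := fun z hz hz' =>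
    hW z η η (hWa z hz) (hWb z hz') (by linarith)
  -- the cross-cut
  set χ : Set ℂ := (((La.P ∪ segment ℝ La.m wa) ∪ M) ∪ segment ℝ wb Lb.m) ∪ Lb.P with hχ
  have h1 : IsSimpleArc (La.P ∪ segment ℝ La.m wa) La.c wa := by
    refine La.arcP.symm.union (IsSimpleArc.segment hwane.symm) ?_
    rintro z ⟨hz1, hz2⟩
    have : z ∈ La.P ∩ segment ℝ La.m La.ztop := ⟨hz1, hSa hz2⟩
    rw [La.inter_eq] at this; exact this
  have h2 : IsSimpleArc ((La.P ∪ segment ℝ La.m wa) ∪ M) La.c wb := by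
    refine h1.union hM ?_
    rintro z ⟨hz1 | hz1, hz2⟩
    · exact absurd hz2 (hPaM z hz1)
    · have : z ∈ M ∩ segment ℝ La.m La.ztop := ⟨hz2, hSa hz1⟩
      rw [hMa] at this; exact this
  have h3 : IsSimpleArc (((La.P ∪ segment ℝ La.m wa) ∪ M) ∪ segment ℝ wb Lb.m) La.c Lb.m := by
    refine h2.union (IsSimpleArc.segment hwbne) ?_
    rintro z ⟨(hz1 | hz1) | hz1, hz2⟩
    · exact absurd (Or.inr (hSb hz2)) (hab z (Or.inl hz1))
    · exact absurd (Or.inr (hSb hz2)) (hab z (Or.inr (hSa hz1)))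
    · have : z ∈ M ∩ segment ℝ Lb.m Lb.ztop := ⟨hz1, hSb hz2⟩
      rw [hMb] at this; exact this
  have h4 : IsSimpleArc χ La.c Lb.c := by
    refine h3.union Lb.arcP ?_
    rintro z ⟨((hz1 | hz1) | hz1) | hz1, hz2⟩
    · exact absurd (Or.inl hz2) (hab z (Or.inl hz1))
    · exact absurd (Or.inl hz2) (hab z (Or.inr (hSa hz1)))
    · exact absurd hz1 (hPbM z hz2)
    · have : z ∈ Lb.P ∩ segment ℝ Lb.m Lb.ztop := ⟨hz2, hSb hz1⟩
      rw [Lb.inter_eq] at this; exact this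
  -- membership bookkeeping
  have hmemχ : ∀ z ∈ χ, z ∈ La.P ∪ segment ℝ La.m La.ztop ∨ z ∈ M ∨ z ∈ Lb.P ∪ segment ℝ Lb.m Lb.ztop := by
    rintro z ((((hz | hz) | hz) | hz) | hz)
    · exact Or.inl (Or.inl hz)
    · exact Or.inl (Or.inr (hSa hz))
    · exact Or.inr (Or.inl hz)
    · exact Or.inr (Or.inr (Or.inr (hSb hz)))
    · exact Or.inr (Or.inr (Or.inl hz))
  have hPaχ : La.P ⊆ χ := fun z hz => Or.inl (Or.inl (Or.inl (Or.inl hz)))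
  have hPbχ : Lb.P ⊆ χ := fun z hz => Or.inr hz
  -- shallow sets avoid `M`
  have hshallow : ∀ z : ℂ, infDist z (frontier J.carrier) ≤ 20 * δ → z ∉ M := fun z hz hzM => by
    have := hMdeep z hzM; linarith
  refine ⟨χ, ⟨h4, La.c_mem, Lb.c_mem, ?_, ?_⟩, ?_, ?_, hPaχ La.z₀_mem, hPbχ Lb.z₀_mem, hPaχ La.pstar_mem,
    hPbχ Lb.pstar_mem, ?_, ?_, ?_, ?_, ?_, ?_, ?_, ?_, ?_, ?_, ?_⟩
  · -- the landing points differ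
    intro h
    refine hab La.c (Or.inl La.arcP.right_mem) (Or.inl ?_)
    rw [h]; exact Lb.arcP.right_mem
  · -- inside the domain but for the ends
    rintro z ⟨hz, hzne⟩
    rw [mem_insert_iff, mem_singleton_iff, not_or] at hzne
    rcases hmemχ z hz with (h | h) | h | (h | h)
    · exact La.subset_Ω ⟨h, hzne.1⟩
    · exact La.run_subset_Ω h
    · exact hMΩ h
    · exact Lb.subset_Ω ⟨h, hzne.2⟩
    · exact Lb.run_subset_Ω h
  · -- boundary-site mesh points are off `χ`
    intro x hx hxχ
    rcases hmemχ _ hxχ with h | h | h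
    · exact La.mesh_not_mem x hx h
    · exact hshallow _ ((hB x hx).trans (by linarith)) h
    · exact Lb.mesh_not_mem x hx h
  · -- closed edges between boundary sites meet `χ` only in the cut midpoints
    intro x hx y hy hxy z hz
    obtain ⟨hzχ, hzs⟩ := hz
    rcases hmemχ _ hzχ with h | h | h
    · exact Or.inl (La.inter_edge_subset x hx y hy hxy ⟨h, hzs⟩)
    · exfalso
      refine hshallow z ?_ h
      have hxy' : (zdGraph 2).Adj x y := meshGraph_le_zdGraph _ _ (discreteDomainGraph_le_meshGraph _ _ hxy)
      have hd : dist z (meshPoint δ x) ≤ δ := by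
        refine (dist_le_dist_of_mem_segment hzs).trans ?_
        rw [dist_meshPoint_of_adj hxy', abs_of_pos hδ]
      linarith [infDist_le_of_near (hB x hx) hd]
    · exact Or.inr (Lb.inter_edge_subset x hx y hy hxy ⟨h, hzs⟩)
  · -- sector at `a`
    rintro z ⟨hzχ, hzb⟩
    rcases hmemχ _ hzχ with h | h | h
    · exact La.inter_ball_subset ⟨h, hzb⟩
    · exact absurd h (hshallow z ((La.infDist_le_of_mem_ball hzb).trans (by linarith)))
    · exfalso
      have h1 := La.ball_z₀_subset hzb
      rw [mem_ball] at h1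
      exact hW z (η + δ) η h1 (hWb z h) (by linarith)
  · -- sector at `b`
    rintro z ⟨hzχ, hzb⟩
    rcases hmemχ _ hzχ with h | h | h
    · exfalso
      have h1 := Lb.ball_z₀_subset hzb
      rw [mem_ball] at h1
      exact hW z η (η + δ) (hWa z h) h1 (by linarith)
    · exact absurd h (hshallow z ((Lb.infDist_le_of_mem_ball hzb).trans (by linarith)))
    · exact Lb.inter_ball_subset ⟨h, hzb⟩
  · -- access from `u` at `a`
    obtain ⟨q, hq, hpos, hsub⟩ := La.access_u
    refine ⟨q, hq, hpos, fun z hz => ⟨(hsub hz).1, fun hzχ => ?_⟩⟩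
    rcases hmemχ _ hzχ with h | h | h
    · exact (hsub hz).2 h
    · refine hshallow z ?_ h
      have hd : dist z (meshPoint δ La.u) ≤ dist (meshPoint δ La.u) q := dist_le_dist_of_mem_segment hz
      have hq' : dist (meshPoint δ La.u) q ≤ 11 * δ := by
        have h1 := La.dist_u_c
        have h2 : dist La.z₀ La.c ≤ 5 * δ := mem_closedBall.1 (La.subset_closedBall La.z₀_mem)
        have h3 : dist q La.z₀ ≤ δ := (mem_ball.1 hq).le.trans La.ε_le
        linarith [dist_triangle (meshPoint δ La.u) La.c q, dist_triangle La.c La.z₀ q, dist_comm La.z₀ La.c, dist_comm q La.z₀]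
      linarith [infDist_le_of_near (hB _ La.u_mem) (hd.trans hq')]
    · have h1 := La.meshPoint_u_mem
      have h2 := La.ball_z₀_subset hq
      have hz' : z ∈ ball a (η + 5 * δ) := (convex_ball a _).segment_subset h1 ((ball_subset_ball (by linarith)) h2) hz
      exact hW z (η + 5 * δ) η hz' (hWb z h) (by linarith)
  · -- access from `v` at `a`
    obtain ⟨q, hq, hpos, hsub⟩ := La.access_v
    refine ⟨q, hq, hpos, fun z hz => ⟨(hsub hz).1, fun hzχ => ?_⟩⟩
    rcases hmemχ _ hzχ with h | h | h
    · exact (hsub hz).2 h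
    · refine hshallow z ?_ h
      have hd : dist z (meshPoint δ La.v) ≤ dist (meshPoint δ La.v) q := dist_le_dist_of_mem_segment hz
      have hq' : dist (meshPoint δ La.v) q ≤ 11 * δ := by
        have h1 := La.dist_v_c
        have h2 : dist La.z₀ La.c ≤ 5 * δ := mem_closedBall.1 (La.subset_closedBall La.z₀_mem)
        have h3 : dist q La.z₀ ≤ δ := (mem_ball.1 hq).le.trans La.ε_le
        linarith [dist_triangle (meshPoint δ La.v) La.c q, dist_triangle La.c La.z₀ q, dist_comm La.z₀ La.c, dist_comm q La.z₀]
      linarith [infDist_le_of_near (hB _ La.v_mem) (hd.trans hq')]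
    · have h1 := La.meshPoint_v_mem
      have h2 := La.ball_z₀_subset hq
      have hz' : z ∈ ball a (η + 5 * δ) := (convex_ball a _).segment_subset h1 ((ball_subset_ball (by linarith)) h2) hz
      exact hW z (η + 5 * δ) η hz' (hWb z h) (by linarith)
  · -- access from `u` at `b`
    obtain ⟨q, hq, hpos, hsub⟩ := Lb.access_u
    refine ⟨q, hq, hpos, fun z hz => ⟨(hsub hz).1, fun hzχ => ?_⟩⟩
    rcases hmemχ _ hzχ with h | h | h
    · have h1 := Lb.meshPoint_u_mem
      have h2 := Lb.ball_z₀_subset hq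
      have hz' : z ∈ ball b (η + 5 * δ) := (convex_ball b _).segment_subset h1 ((ball_subset_ball (by linarith)) h2) hz
      exact hW z η (η + 5 * δ) (hWa z h) hz' (by linarith)
    · refine hshallow z ?_ h
      have hd : dist z (meshPoint δ Lb.u) ≤ dist (meshPoint δ Lb.u) q := dist_le_dist_of_mem_segment hz
      have hq' : dist (meshPoint δ Lb.u) q ≤ 11 * δ := by
        have h1 := Lb.dist_u_c
        have h2 : dist Lb.z₀ Lb.c ≤ 5 * δ := mem_closedBall.1 (Lb.subset_closedBall Lb.z₀_mem)
        have h3 : dist q Lb.z₀ ≤ δ := (mem_ball.1 hq).le.trans Lb.ε_le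
        linarith [dist_triangle (meshPoint δ Lb.u) Lb.c q, dist_triangle Lb.c Lb.z₀ q, dist_comm Lb.z₀ Lb.c, dist_comm q Lb.z₀]
      linarith [infDist_le_of_near (hB _ Lb.u_mem) (hd.trans hq')]
    · exact (hsub hz).2 h
  · -- access from `v` at `b`
    obtain ⟨q, hq, hpos, hsub⟩ := Lb.access_v
    refine ⟨q, hq, hpos, fun z hz => ⟨(hsub hz).1, fun hzχ => ?_⟩⟩
    rcases hmemχ _ hzχ with h | h | h
    · have h1 := Lb.meshPoint_v_mem
      have h2 := Lb.ball_z₀_subset hq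
      have hz' : z ∈ ball b (η + 5 * δ) := (convex_ball b _).segment_subset h1 ((ball_subset_ball (by linarith)) h2) hz
      exact hW z η (η + 5 * δ) (hWa z h) hz' (by linarith)
    · refine hshallow z ?_ h
      have hd : dist z (meshPoint δ Lb.v) ≤ dist (meshPoint δ Lb.v) q := dist_le_dist_of_mem_segment hz
      have hq' : dist (meshPoint δ Lb.v) q ≤ 11 * δ := by
        have h1 := Lb.dist_v_c
        have h2 : dist Lb.z₀ Lb.c ≤ 5 * δ := mem_closedBall.1 (Lb.subset_closedBall Lb.z₀_mem)
        have h3 : dist q Lb.z₀ ≤ δ := (mem_ball.1 hq).le.trans Lb.ε_le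
        linarith [dist_triangle (meshPoint δ Lb.v) Lb.c q, dist_triangle Lb.c Lb.z₀ q, dist_comm Lb.z₀ Lb.c, dist_comm q Lb.z₀]
      linarith [infDist_le_of_near (hB _ Lb.v_mem) (hd.trans hq')]
    · exact (hsub hz).2 h
  · -- box beyond `v` at `a`
    intro p hp hpΩ α β h0 h2 hb1 hb2 heq
    have hnear : dist p (meshPoint δ La.v) ≤ 3 * δ := by
      rw [heq, dist_eq_norm, show meshPoint δ La.v + α • meshPoint δ (cornerUnit La.mv) +
        β • meshPoint δ (cornerUnit (La.mv + 1)) - meshPoint δ La.v =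
        α • meshPoint δ (cornerUnit La.mv) + β • meshPoint δ (cornerUnit (La.mv + 1)) by abel]
      refine (norm_add_le _ _).trans ?_
      rw [norm_smul, norm_smul, norm_meshPoint_cornerUnit, norm_meshPoint_cornerUnit, abs_of_pos hδ,
        Real.norm_eq_abs, Real.norm_eq_abs, abs_of_nonneg h0]
      have : |β| ≤ 1 := abs_le.2 ⟨hb1, hb2⟩
      nlinarith
    rcases hmemχ _ hp with h | h | h
    · exact La.box_v p h hpΩ α β h0 h2 hb1 hb2 heq
    · exact hshallow p (by linarith [infDist_le_of_near (hB _ La.v_mem) hnear]) h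
    · have h1 := La.meshPoint_v_mem; rw [mem_ball] at h1
      exact hW p (η + 8 * δ) η (by linarith [dist_triangle p (meshPoint δ La.v) a]) (hWb p h) (by linarith)
  · -- box beyond `u` at `a`
    intro p hp hpΩ α β h0 h2 hb1 hb2 heq
    have hnear : dist p (meshPoint δ La.u) ≤ 3 * δ := by
      rw [heq, dist_eq_norm, show meshPoint δ La.u + α • meshPoint δ (cornerUnit (La.mv + 2)) +
        β • meshPoint δ (cornerUnit (La.mv + 2 + 1)) - meshPoint δ La.u =
        α • meshPoint δ (cornerUnit (La.mv + 2)) + β • meshPoint δ (cornerUnit (La.mv + 2 + 1)) by abel]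
      refine (norm_add_le _ _).trans ?_
      rw [norm_smul, norm_smul, norm_meshPoint_cornerUnit, norm_meshPoint_cornerUnit, abs_of_pos hδ,
        Real.norm_eq_abs, Real.norm_eq_abs, abs_of_nonneg h0]
      have : |β| ≤ 1 := abs_le.2 ⟨hb1, hb2⟩
      nlinarith
    rcases hmemχ _ hp with h | h | h
    · exact La.box_u p h hpΩ α β h0 h2 hb1 hb2 heq
    · exact hshallow p (by linarith [infDist_le_of_near (hB _ La.u_mem) hnear]) h
    · have h1 := La.meshPoint_u_mem; rw [mem_ball] at h1
      exact hW p (η + 8 * δ) η (by linarith [dist_triangle p (meshPoint δ La.u) a]) (hWb p h) (by linarith)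
  · -- box beyond `v` at `b`
    intro p hp hpΩ α β h0 h2 hb1 hb2 heq
    have hnear : dist p (meshPoint δ Lb.v) ≤ 3 * δ := by
      rw [heq, dist_eq_norm, show meshPoint δ Lb.v + α • meshPoint δ (cornerUnit Lb.mv) +
        β • meshPoint δ (cornerUnit (Lb.mv + 1)) - meshPoint δ Lb.v =
        α • meshPoint δ (cornerUnit Lb.mv) + β • meshPoint δ (cornerUnit (Lb.mv + 1)) by abel]
      refine (norm_add_le _ _).trans ?_
      rw [norm_smul, norm_smul, norm_meshPoint_cornerUnit, norm_meshPoint_cornerUnit, abs_of_pos hδ,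
        Real.norm_eq_abs, Real.norm_eq_abs, abs_of_nonneg h0]
      have : |β| ≤ 1 := abs_le.2 ⟨hb1, hb2⟩
      nlinarith
    rcases hmemχ _ hp with h | h | h
    · have h1 := Lb.meshPoint_v_mem; rw [mem_ball] at h1
      exact hW p η (η + 8 * δ) (hWa p h) (by linarith [dist_triangle p (meshPoint δ Lb.v) b]) (by linarith)
    · exact hshallow p (by linarith [infDist_le_of_near (hB _ Lb.v_mem) hnear]) h
    · exact Lb.box_v p h hpΩ α β h0 h2 hb1 hb2 heq
  · -- box beyond `u` at `b`
    intro p hp hpΩ α β h0 h2 hb1 hb2 heq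
    have hnear : dist p (meshPoint δ Lb.u) ≤ 3 * δ := by
      rw [heq, dist_eq_norm, show meshPoint δ Lb.u + α • meshPoint δ (cornerUnit (Lb.mv + 2)) +
        β • meshPoint δ (cornerUnit (Lb.mv + 2 + 1)) - meshPoint δ Lb.u =
        α • meshPoint δ (cornerUnit (Lb.mv + 2)) + β • meshPoint δ (cornerUnit (Lb.mv + 2 + 1)) by abel]
      refine (norm_add_le _ _).trans ?_
      rw [norm_smul, norm_smul, norm_meshPoint_cornerUnit, norm_meshPoint_cornerUnit, abs_of_pos hδ,
        Real.norm_eq_abs, Real.norm_eq_abs, abs_of_nonneg h0]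
      have : |β| ≤ 1 := abs_le.2 ⟨hb1, hb2⟩
      nlinarith
    rcases hmemχ _ hp with h | h | h
    · have h1 := Lb.meshPoint_u_mem; rw [mem_ball] at h1
      exact hW p η (η + 8 * δ) (hWa p h) (by linarith [dist_triangle p (meshPoint δ Lb.u) b]) (by linarith)
    · exact hshallow p (by linarith [infDist_le_of_near (hB _ Lb.u_mem) hnear]) h
    · exact Lb.box_u p h hpΩ α β h0 h2 hb1 hb2 heq
  · -- windows or deep
    intro z hz
    rcases hmemχ _ hz with h | h | h
    · exact Or.inl (hWa z h)
    · exact Or.inr (Or.inr (hMdeep z h))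
    · exact Or.inr (Or.inl (hWb z h))

end Main

end Summit.CriticalPhenomena.CardyFormulaZ2.Theorems.DiscretisationFamilyExists

end
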